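import Literature.NumberTheory.GaloisRepresentations.ArchCompletionEmbedding
import Literature.NumberTheory.GaloisRepresentations.ArchHomAssembly
import Literature.NumberTheory.GaloisRepresentations.KummerSES
import HarnessLib

/-!
# Local equivariant homomorphisms `X → K̄_vˣ` at an INFINITE place versus `G`-morphisms `X → ∏_{w∣v} E_wˣ`:
# the archimedean factor of `Hom_G(N₁, J_E) = ∏'_v Hom_{Γ_{K_v}}(N₁, K̄_vˣ)` (Milne *ADT* I Lemma 4.13; C–F VII §1.1)

Topic `NumberTheory/GaloisRepresentations`; namespace `Literature.NumberTheory.GaloisRepresentations.IdeleReadout`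
(`ArchHerbrand`, `DiscreteGaloisModule` opened).  Definitions with bodies and theorems; NO named fact, no `sorry`, no
instance, no notation; number fields in `Type`.  The archimedean twin of door-c5 g17's `IdeleReadoutLocalHom.lean`,
from `ArchCompletionEmbedding.lean` (`archEmbPlace v ιE = w_v`, `archPlaceEmb : E_{w_v} →+* K̄_v`, its equivariance,
`archGalRestrictStab_surjective`, `exists_archPlaceEmb_eq_of_forall_smul`) and `ArchHomAssembly.lean` (`archAssemble`,
`archTransport`, `archProj_archAssemble`, `eq_archAssemble_of_archProj_eq`).

Why (Route A of crux `AnticycControlAdditiveK`, item 19295; door-c6 g16 presentation road, (R-def)/(R3) at the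
infinite places: "archimedean places: F4c applies verbatim").  A homomorphism `h : X → K̄_vˣ` equivariant for
`Γ_{K_v}` acting through `d ↦ d|_E` takes values in `archPlaceEmb(E_{w_v})` (kernel-fixed), so `archPlaceEmb⁻¹ ∘ h`
is a naive `Stab(w_v)`-equivariant map `X → E_{w_v}ˣ`, which `archAssemble` extends to `X ⟶ ∏_{w∣v} E_wˣ`
(`assembleArchLocalHom`); conversely `archPlaceEmb ∘ pr_{w_v} ∘ Φ` is such an `h` (`archLocalReadout`), and the two are
inverse.  No unit condition at infinite places.

## What is formalised (`K E : Type`, `[CharZero K]`, `[FiniteDimensional K E] [IsGalois K E]`, `ιE`, `v : InfinitePlace K`,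
## `X : Rep ℤ Gal(E/K)`)

* `IsArchLocalHom v ιE X h`, `exists_archPlaceEmb_eq_of_isArchLocalHom`, `archLocalHomUnit` (+ `_eq_iff`, `_add`, `_zero`,
  **`archLocalHomUnit_ρ`**), `archLocalHomLiftAddHom`, **`isStabHom_archLocalHomLift`**,
  **`assembleArchLocalHom hh : X ⟶ archUnitsRep v`**, **`archPlaceEmb_archProj_assembleArchLocalHom`**
  (`archPlaceEmb ((Φ x)_{w_v}) = h x`).
* **`archLocalReadout v ιE Φ : X.V →+ UnitsCarrier K_v`**, `coe_unitsVal_archLocalReadout`,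
  **`isArchLocalHom_archLocalReadout`**, **`archLocalReadout_assembleArchLocalHom`** (`= h`),
  **`arch_hom_ext_of_archLocalReadout_eq`** (a `G`-morphism into `∏_{w∣v} E_wˣ` is determined by its readout).

## References
* J. S. Milne, *Arithmetic Duality Theorems* (2nd ed. 2006), I Lemma 4.13 (proof), I §4. [MilneADT2006]
* J. W. S. Cassels, A. Fröhlich (eds.), *Algebraic Number Theory* (1967), Ch. VII (Tate) §1.1, §7.3. [CasselsFrohlichANT1967]
* D. Harari, *Galois Cohomology and Class Field Theory* (2020), §13.1. [Harari2020]
-/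

noncomputable section

open NumberField NumberField.InfinitePlace Field CategoryTheory
open Literature.NumberTheory.Automorphic

namespace Literature.NumberTheory.GaloisRepresentations

namespace IdeleReadout

open ArchHerbrand DiscreteGaloisModule

variable {K : Type} [Field K] {E : Type} [Field E] [Algebra K E] [FiniteDimensional K E] [IsGalois K E]
variable (v : InfinitePlace K) (ιE : E →ₐ[K] AlgebraicClosure K) {X : Rep.{0} ℤ (E ≃ₐ[K] E)}

/-! ## §1. From a `Γ_{K_v}`-equivariant `h : X → K̄_vˣ` to a `G`-morphism `X ⟶ ∏_{w∣v} E_wˣ` -/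

/-- **Local equivariance at an infinite place**: `h(d|_E • x) = d • h(x)` for `d ∈ Γ_{K_v}`.
[cite: MilneADT2006, I Lemma 4.13 (proof), I §4] -/
def IsArchLocalHom (X : Rep.{0} ℤ (E ≃ₐ[K] E)) (h : X.V →+ UnitsCarrier v.Completion) : Prop :=
  ∀ (d : absoluteGaloisGroup v.Completion) (x : X.V),
    h (X.ρ (galRestrictField v.Completion ιE d) x) = units v.Completion d (h x)

variable {v ιE}

omit [FiniteDimensional K E] in
/-- The values of a local equivariant `h` are fixed by the kernel of `d ↦ d|_E`. [cite: CasselsFrohlichANT1967, Ch. VII §1.1] -/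
theorem smul_unitsVal_of_isArchLocalHom {h : X.V →+ UnitsCarrier v.Completion} (hh : IsArchLocalHom v ιE X h)
    {d : absoluteGaloisGroup v.Completion} (hd : galRestrictField v.Completion ιE d = 1) (x : X.V) :
    d • (unitsVal v.Completion (h x) : AlgebraicClosure v.Completion) = unitsVal v.Completion (h x) := by
  letI : Module ℤ X.V := X.hV2
  have h1 := hh d x
  rw [hd, map_one, Module.End.one_apply] at h1
  rw [← Units.coe_smul, ← unitsVal_apply, ← h1]

section Lift

variable [CharZero K]

/-- **The values of a local equivariant `h` lie in `archPlaceEmb(E_{w_v})`.** [cite: CasselsFrohlichANT1967, Ch. VII §1.1] -/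
theorem exists_archPlaceEmb_eq_of_isArchLocalHom {h : X.V →+ UnitsCarrier v.Completion}
    (hh : IsArchLocalHom v ιE X h) (x : X.V) :
    ∃ y, archPlaceEmb v ιE y = (unitsVal v.Completion (h x) : AlgebraicClosure v.Completion) :=
  exists_archPlaceEmb_eq_of_forall_smul v ιE fun _ hd => smul_unitsVal_of_isArchLocalHom hh hd x

/-- The value `archPlaceEmb⁻¹ (h x) ∈ E_{w_v}` (auxiliary). [cite: CasselsFrohlichANT1967, Ch. VII §1.1] -/
def archLocalHomVal {h : X.V →+ UnitsCarrier v.Completion} (hh : IsArchLocalHom v ιE X h) (x : X.V) :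
    (archEmbPlace v ιE).Completion :=
  Classical.choose (exists_archPlaceEmb_eq_of_isArchLocalHom hh x)

/-- `archPlaceEmb (archPlaceEmb⁻¹ (h x)) = h x`. [cite: CasselsFrohlichANT1967, Ch. VII §1.1] -/
theorem archPlaceEmb_archLocalHomVal {h : X.V →+ UnitsCarrier v.Completion} (hh : IsArchLocalHom v ιE X h) (x : X.V) :
    archPlaceEmb v ιE (archLocalHomVal hh x) = (unitsVal v.Completion (h x) : AlgebraicClosure v.Completion) :=
  Classical.choose_spec (exists_archPlaceEmb_eq_of_isArchLocalHom hh x)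

/-- `archPlaceEmb⁻¹ (h x) ≠ 0`. [cite: CasselsFrohlichANT1967, Ch. VII §1.1] -/
theorem archLocalHomVal_ne_zero {h : X.V →+ UnitsCarrier v.Completion} (hh : IsArchLocalHom v ιE X h) (x : X.V) :
    archLocalHomVal hh x ≠ 0 := fun h0 => by
  have h1 := archPlaceEmb_archLocalHomVal hh x
  rw [h0, map_zero] at h1
  exact (unitsVal v.Completion (h x)).ne_zero h1.symm

/-- `archPlaceEmb⁻¹ (h x)` as a unit of `E_{w_v}`. [cite: CasselsFrohlichANT1967, Ch. VII §1.1] -/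
def archLocalHomUnit {h : X.V →+ UnitsCarrier v.Completion} (hh : IsArchLocalHom v ιE X h) (x : X.V) :
    ((archEmbPlace v ιE).Completion)ˣ :=
  Units.mk0 (archLocalHomVal hh x) (archLocalHomVal_ne_zero hh x)

/-- Characterisation: `archLocalHomUnit hh x = u ↔ archPlaceEmb u = h x`. [cite: CasselsFrohlichANT1967, Ch. VII §1.1] -/
theorem archLocalHomUnit_eq_iff {h : X.V →+ UnitsCarrier v.Completion} (hh : IsArchLocalHom v ιE X h) (x : X.V)
    (u : ((archEmbPlace v ιE).Completion)ˣ) :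
    archLocalHomUnit hh x = u ↔
      archPlaceEmb v ιE (u : (archEmbPlace v ιE).Completion) = (unitsVal v.Completion (h x) : AlgebraicClosure v.Completion) := by
  constructor
  · rintro rfl
    exact archPlaceEmb_archLocalHomVal hh x
  · intro hu
    exact Units.ext (archPlaceEmb_injective v ιE ((archPlaceEmb_archLocalHomVal hh x).trans hu.symm))

/-- Additivity. [cite: CasselsFrohlichANT1967, Ch. VII §1.1] -/
theorem archLocalHomUnit_add {h : X.V →+ UnitsCarrier v.Completion} (hh : IsArchLocalHom v ιE X h) (x y : X.V) :
    archLocalHomUnit hh (x + y) = archLocalHomUnit hh x * archLocalHomUnit hh y := by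
  rw [archLocalHomUnit_eq_iff, Units.val_mul, map_mul, map_add, unitsVal_add, Units.val_mul]
  change archPlaceEmb v ιE (archLocalHomVal hh x) * archPlaceEmb v ιE (archLocalHomVal hh y) = _
  rw [archPlaceEmb_archLocalHomVal, archPlaceEmb_archLocalHomVal]

/-- `archLocalHomUnit hh 0 = 1`. [cite: CasselsFrohlichANT1967, Ch. VII §1.1] -/
theorem archLocalHomUnit_zero {h : X.V →+ UnitsCarrier v.Completion} (hh : IsArchLocalHom v ιE X h) :
    archLocalHomUnit hh 0 = 1 := by
  rw [archLocalHomUnit_eq_iff, Units.val_one, map_one, map_zero]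
  rfl

/-- **Naive `Stab(w_v)`-equivariance of `archPlaceEmb⁻¹ ∘ h`**: `u(g x) = g_{w_v}(u x)` for `g • w_v = w_v` (choose
`d ∈ Γ_{K_v}` with `d|_E = g`, `archGalRestrictStab_surjective`). [cite: CasselsFrohlichANT1967, Ch. VII §1.1] -/
theorem archLocalHomUnit_ρ {h : X.V →+ UnitsCarrier v.Completion} (hh : IsArchLocalHom v ιE X h)
    (g : E ≃ₐ[K] E) (hg : g • archEmbPlace v ιE = archEmbPlace v ιE) (x : X.V) :
    (archLocalHomUnit hh (X.ρ g x) : (archEmbPlace v ιE).Completion) =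
      galInfiniteCompletionMap g hg (archLocalHomUnit hh x : (archEmbPlace v ιE).Completion) := by
  obtain ⟨d, hd⟩ := archGalRestrictStab_surjective v ιE ⟨g, MulAction.mem_stabilizer_iff.mpr hg⟩
  have hgd : g = galRestrictField v.Completion ιE d := (congrArg Subtype.val hd).symm
  apply archPlaceEmb_injective v ιE
  rw [archPlaceEmb_galInfiniteCompletionMap v ιE hgd]
  change archPlaceEmb v ιE (archLocalHomVal hh (X.ρ g x)) = d • archPlaceEmb v ιE (archLocalHomVal hh x)
  rw [archPlaceEmb_archLocalHomVal, archPlaceEmb_archLocalHomVal, hgd, hh d x, unitsVal_apply, Units.coe_smul]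

/-- **`archPlaceEmb⁻¹ ∘ h` as an additive map `X → Additive E_{w_v}ˣ`.** [cite: CasselsFrohlichANT1967, Ch. VII §1.1] -/
def archLocalHomLiftAddHom {h : X.V →+ UnitsCarrier v.Completion} (hh : IsArchLocalHom v ιE X h) :
    X.V →+ Additive ((archEmbPlace v ιE).Completion)ˣ where
  toFun x := Additive.ofMul (archLocalHomUnit hh x)
  map_zero' := by rw [archLocalHomUnit_zero]; rfl
  map_add' x y := by rw [archLocalHomUnit_add]; rfl

/-- Unfolding. [cite: CasselsFrohlichANT1967, Ch. VII §1.1] -/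
theorem toMul_archLocalHomLiftAddHom {h : X.V →+ UnitsCarrier v.Completion} (hh : IsArchLocalHom v ιE X h) (x : X.V) :
    Additive.toMul (archLocalHomLiftAddHom hh x) = archLocalHomUnit hh x := rfl

/-- **`archPlaceEmb⁻¹ ∘ h` is naively `Stab(w_v)`-equivariant.** [cite: CasselsFrohlichANT1967, Ch. VII §1.1] -/
theorem isStabHom_archLocalHomLift {h : X.V →+ UnitsCarrier v.Completion} (hh : IsArchLocalHom v ιE X h) :
    IsStabHom (archEmbPlace v ιE) X (archLocalHomLiftAddHom hh) := fun g hg x => by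
  rw [toMul_archLocalHomLiftAddHom, toMul_archLocalHomLiftAddHom]
  exact archLocalHomUnit_ρ hh g hg x

/-- **The `G`-morphism `X ⟶ ∏_{w∣v} E_wˣ` at an infinite place assembled from a local equivariant `h : X → K̄_vˣ`**
(`archAssemble`, transported along `w_v ∣ v`). [cite: MilneADT2006, I Lemma 4.13 (proof)] [cite: Harari2020, §13.1] -/
def assembleArchLocalHom {h : X.V →+ UnitsCarrier v.Completion} (hh : IsArchLocalHom v ιE X h) :
    X ⟶ archUnitsRep (E := E) v :=
  archTransport (isOver_archEmbPlace v ιE) (archAssemble (isStabHom_archLocalHomLift hh))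

/-- **The `w_v`-component of the assembled morphism, pushed into `K̄_v`, is `h`**:
`archPlaceEmb ((Φ x)_{w_v}) = h x`. [cite: MilneADT2006, I Lemma 4.13 (proof)] -/
theorem archPlaceEmb_archProj_assembleArchLocalHom {h : X.V →+ UnitsCarrier v.Completion} (hh : IsArchLocalHom v ιE X h)
    (x : X.V) :
    archPlaceEmb v ιE ((Additive.toMul (archProj (E := E) v (archEmbPlace v ιE) ((assembleArchLocalHom hh).hom x)) :
        ((archEmbPlace v ιE).Completion)ˣ) : (archEmbPlace v ιE).Completion) =
      (unitsVal v.Completion (h x) : AlgebraicClosure v.Completion) := by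
  rw [assembleArchLocalHom, coe_toMul_archProj_archTransport, archProj_archAssemble, toMul_archLocalHomLiftAddHom]
  exact archPlaceEmb_archLocalHomVal hh x

end Lift

/-! ## §2. Conversely: the readout `archPlaceEmb ∘ pr_{w_v} ∘ Φ` -/

variable (v ιE)

omit [FiniteDimensional K E] [IsGalois K E] in
/-- Transport along `w₀ ∣ v` is onto: every morphism into `archUnitsRep v` comes from `archUnitsRep (w₀|_K)`.
[cite: CasselsFrohlichANT1967, Ch. VII §7.3] -/
theorem archTransport_surjective {v : InfinitePlace K} {w₀ : InfinitePlace E} (hw : IsOver E v w₀)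
    (Φ : X ⟶ archUnitsRep (E := E) v) : ∃ Φ' : X ⟶ archUnitsRep (E := E) (w₀.comap (algebraMap K E)), archTransport hw Φ' = Φ := by
  subst hw
  exact ⟨Φ, rfl⟩

omit [FiniteDimensional K E] [IsGalois K E] in
/-- The `w`-component of `g • u` at a place `w` fixed by `g`: `pr_w(g • u) = g_w(pr_w u)`.
[cite: CasselsFrohlichANT1967, Ch. VII §1.1] -/
theorem coe_toMul_archProj_ρ_of_smul_eq (w : InfinitePlace E) (g : E ≃ₐ[K] E) (hg : g • w = w)
    (u : Additive (infUnits E v)) :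
    ((Additive.toMul (archProj (E := E) v w (archUnitsRepr (E := E) v g u)) : (w.Completion)ˣ) : w.Completion) =
      galInfiniteCompletionMap g hg ((Additive.toMul (archProj (E := E) v w u) : (w.Completion)ˣ) : w.Completion) := by
  rw [coe_toMul_archProj, coe_toMul_archProj, Herbrand.coe_toMul_stableRepr, MulDistribMulAction.toMulAut_apply,
    MulDistribMulAction.toMulEquiv_apply, smul_units_apply]
  exact galInfiniteCompletionMap_apply_congr_place K (inv_smul_eq_iff.mpr hg.symm) _ _ _

/-- **The local readout `X → K̄_vˣ` of a `G`-morphism `Φ : X ⟶ ∏_{w∣v} E_wˣ` at an infinite place**: the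
`w_v`-component followed by `archPlaceEmb`. [cite: MilneADT2006, I Lemma 4.13 (proof)] [cite: Harari2020, §13.1] -/
def archLocalReadout (Φ : X ⟶ archUnitsRep (E := E) v) : X.V →+ UnitsCarrier v.Completion :=
  letI : Module ℤ X.V := X.hV2
  (MonoidHom.toAdditive (Units.map (archPlaceEmb v ιE).toMonoidHom)).comp
    ((archProj (E := E) v (archEmbPlace v ιE)).toAddMonoidHom.comp Φ.hom.toLinearMap.toAddMonoidHom)

/-- Unfolding: `unitsVal (archLocalReadout Φ x) = archPlaceEmb ((Φ x)_{w_v})` in `K̄_v`. [cite: MilneADT2006, I Lemma 4.13 (proof)] -/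
theorem coe_unitsVal_archLocalReadout (Φ : X ⟶ archUnitsRep (E := E) v) (x : X.V) :
    (unitsVal v.Completion (archLocalReadout v ιE Φ x) : AlgebraicClosure v.Completion) =
      archPlaceEmb v ιE ((Additive.toMul (archProj (E := E) v (archEmbPlace v ιE) (Φ.hom x)) :
        ((archEmbPlace v ιE).Completion)ˣ) : (archEmbPlace v ιE).Completion) := rfl

/-- **The readout of a `G`-morphism is `Γ_{K_v}`-equivariant.** [cite: MilneADT2006, I Lemma 4.13 (proof)]
[cite: CasselsFrohlichANT1967, Ch. VII §1.1] -/
theorem isArchLocalHom_archLocalReadout (Φ : X ⟶ archUnitsRep (E := E) v) :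
    IsArchLocalHom v ιE X (archLocalReadout v ιE Φ) := by
  intro d x
  apply unitsVal_injective
  apply Units.ext
  rw [unitsVal_apply, Units.coe_smul, coe_unitsVal_archLocalReadout, coe_unitsVal_archLocalReadout, Rep.hom_comm_apply,
    ← archPlaceEmb_galInfiniteCompletionMap v ιE rfl (galRestrictField_smul_archEmbPlace v ιE d)]
  congr 1
  exact coe_toMul_archProj_ρ_of_smul_eq v _ _ (galRestrictField_smul_archEmbPlace v ιE d)
    (show Additive (infUnits E v) from Φ.hom x)

variable {v ιE}

/-- **A `G`-morphism `X ⟶ ∏_{w∣v} E_wˣ` at an infinite place is determined by its local readout.**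
[cite: MilneADT2006, I Lemma 4.13 (proof)] -/
theorem arch_hom_ext_of_archLocalReadout_eq {Φ Ψ : X ⟶ archUnitsRep (E := E) v}
    (h : archLocalReadout v ιE Φ = archLocalReadout v ιE Ψ) : Φ = Ψ := by
  -- pass to `archUnitsRep (w_v|_K)` along `w_v ∣ v`, where morphisms are determined by their `w_v`-components
  obtain ⟨Φ', rfl⟩ := archTransport_surjective (isOver_archEmbPlace v ιE) Φ
  obtain ⟨Ψ', rfl⟩ := archTransport_surjective (isOver_archEmbPlace v ιE) Ψ
  congr 1
  refine arch_hom_ext_of_archProj_eq (w₀ := archEmbPlace v ιE) fun x => ?_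
  apply Additive.toMul.injective
  apply Units.ext
  apply archPlaceEmb_injective v ιE
  have hx : (unitsVal v.Completion (archLocalReadout v ιE (archTransport (isOver_archEmbPlace v ιE) Φ') x) :
      AlgebraicClosure v.Completion) =
      unitsVal v.Completion (archLocalReadout v ιE (archTransport (isOver_archEmbPlace v ιE) Ψ') x) := by rw [h]
  rwa [coe_unitsVal_archLocalReadout, coe_unitsVal_archLocalReadout, coe_toMul_archProj_archTransport,
    coe_toMul_archProj_archTransport] at hx

section LiftReadout

variable [CharZero K]

/-- **`archLocalReadout (assembleArchLocalHom h) = h`.** [cite: MilneADT2006, I Lemma 4.13 (proof)] -/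
theorem archLocalReadout_assembleArchLocalHom {h : X.V →+ UnitsCarrier v.Completion} (hh : IsArchLocalHom v ιE X h) :
    archLocalReadout v ιE (assembleArchLocalHom hh) = h := by
  refine AddMonoidHom.ext fun x => unitsVal_injective _ (Units.ext ?_)
  rw [coe_unitsVal_archLocalReadout]
  exact archPlaceEmb_archProj_assembleArchLocalHom hh x

/-- **`assembleArchLocalHom (archLocalReadout Φ) = Φ`.** [cite: MilneADT2006, I Lemma 4.13 (proof)] -/
theorem assembleArchLocalHom_archLocalReadout (Φ : X ⟶ archUnitsRep (E := E) v) :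
    assembleArchLocalHom (isArchLocalHom_archLocalReadout v ιE Φ) = Φ :=
  arch_hom_ext_of_archLocalReadout_eq (ιE := ιE) (archLocalReadout_assembleArchLocalHom _)

end LiftReadout

end IdeleReadout

end Literature.NumberTheory.GaloisRepresentations

end
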